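import Summits.HodgeConjecture.HodgeConjecture.Theorems.Ring2AbelianAllAndrePolarTriplesSum
import Summits.HodgeConjecture.HodgeConjecture.Theorems.Ring2AbelianAllAndrePolarOctuplesTop
import HarnessLib

/-!
# Ring 2 · sub-cell AbelianAll (ALL ABELIAN VARIETIES), André axis, part XXXVIII-m — THE TRACED DOUBLE SUM ON `H⁴`:
# `(k+1)(k+2) Σ_{a,c} τ(u₁u₂u₃u₄ y_a y_c θᵏ) b_a b_c = 2(k+2) τ(u₁u₂u₃u₄ θ^{k+1}) θ − 2 Λ_τ(u₁u₂u₃u₄)` (`k + 3 = dim A`)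
# — the sum `T_{2,4}` of the Kleiman identity of the block `b = 3` (abelian-FIVEFOLD pencils, o124)

HONEST FRAMING (page 1, verbatim): **research route, not a corollary; conditional on HC_CM plus one named
minimal statement.** Cell line: research route conditional on HC_CM; not a corollary; Q11.4-sentence-2
already refuted in dim ≥ 3. Nothing in this file proves a case of the Hodge conjecture; `HC_CM` does not occur.

Gen-30 file of the `ab-andre-2` seat (cell `pub-hodge-ring2`, sub-cell AbelianAll = ALL abelian varieties, not Weil-type-only).

## What this file proves (sorry-free, standard axioms only; RATIONAL Betti carriers, COR-CM model layer)

**`sum_sum_smul_cup_four_eq`** — for `A : AbelianVariety ℂ` with `k + 3 = dim A`, a basis `b` of `H¹(A(ℂ); ℚ)`, `θ` with polar family `y`, every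
linear functional `τ` on the top degree and one-forms `u₁, …, u₄` (`P_{ij} = τ(u_i u_j θ^{k+2})`):
`(k+1)(k+2) Σ_a Σ_c τ(u₁u₂u₃u₄ y_a y_c θᵏ) · b_a ∪ b_c = 2(k+2) τ(u₁u₂u₃u₄ θ^{k+1}) · θ − 2 (P₁₂ u₃u₄ − P₁₃ u₂u₄ + P₂₃ u₁u₄ + P₁₄ u₂u₃ − P₂₄ u₁u₃ + P₃₄ u₁u₂)`.
This is the second of the three `T`-sums entering the block `b = 3` (part XXXVIII-h is `T_{3,3}`, part XXXVIII-e₁ is `T_{2,2}`); the remaining one,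
`T_{4,4}` on `⋀⁴H¹` (three single-`ℓ` words), follows from part XXXVIII-l's four-pair matching step, this file and part XXXVIII-h (o124).

PRINT: Kleiman, Dix exposés, App. to §2, 2A8–2A11; [MumfordAV1970, §1 (4), §16]. LEAN: displayed theorem, definition-free, fact-free.
-/

noncomputable section

set_option linter.dupNamespace false

namespace Summit.HodgeConjecture.HodgeConjecture.Ring2.AbelianAll

open CategoryTheory MonoidalCategory CartesianMonoidalCategory
open Literature.AlgebraicTopology.SingularHomology
open Literature.AlgebraicTopology.CharacteristicClasses (cupPow cupPow_zero cupPow_succ)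
open Literature.AlgebraicGeometry.Motives (SchemeOver ComplexPoints IsSmoothProjective bettiCohomology AbelianVariety)
open Literature.AlgebraicGeometry.HodgeTheory
open Summit.HodgeConjecture.CorCM.Model
open scoped MonObj

variable (A : AbelianVariety ℂ)

/-- **THE TRACED DOUBLE SUM ON `H⁴` (pure wedges).** For `k + 3 = dim A`, a basis `b`, the polar family `y` of `θ`, every linear functional `τ` on the
top degree and `u₁, u₂, u₃, u₄ ∈ H¹(A(ℂ); ℚ)` (`P_{ij} := τ(u_i u_j θ^{k+2})`):
`(k+1)(k+2) · Σ_a Σ_c τ(u₁u₂u₃u₄ y_a y_c θᵏ) · b_a ∪ b_c = 2(k+2) τ(u₁u₂u₃u₄ θ^{k+1}) · θ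
  − 2 · (P₁₂ · u₃u₄ − P₁₃ · u₂u₄ + P₂₃ · u₁u₄ + P₁₄ · u₂u₃ − P₂₄ · u₁u₃ + P₃₄ · u₁u₂)` — the sum `T_{2,4}` of the block `b = 3`:
`End_{Sp}`-equivariantly, `[contraction of ⋀⁴H¹ against ℓ²-type classes] = (trace) · L − 2 · (Λ_τ-contraction)`. Proof: the matching step with five
free one-forms (part XXXVIII-l), part XXXVIII-g's three-plain-one-polar formula at `k + 1`, `Σ_c b^*_c(z) b_c = z`, Euler `Σ_a b_a y_a = 2θ`.
[cite: MumfordAV1970, §16] [cite: Kleiman1968AlgebraicCycles, App. to §2, 2A8–2A11] -/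
theorem sum_sum_smul_cup_four_eq {n k : ℕ} (hk : k + 3 = A.dim) (b : Module.Basis (Fin n) ℚ (bettiCohomology A.X 1))
    {θ : bettiCohomology A.X 2} {y : Fin n → bettiCohomology A.X 1}
    (hℓ : BettiUniverse.pull μ[A.X] 2 θ - BettiUniverse.pull (fst A.X A.X) 2 θ - BettiUniverse.pull (snd A.X A.X) 2 θ =
      ∑ a, BettiUniverse.cup (A.X ⊗ A.X) 1 1 (BettiUniverse.pull (fst A.X A.X) 1 (b a))
        (BettiUniverse.pull (snd A.X A.X) 1 (y a)))
    (τ : bettiCohomology A.X (2 * k + 1 + 1 + 1 + 1 + 1 + 1) →ₗ[ℚ] ℚ) (u₁ u₂ u₃ u₄ : bettiCohomology A.X 1) :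
    (((k + 1) * (k + 2) : ℕ) : ℚ) • ∑ a, ∑ c,
        τ (cupProduct (Nat.add_comm 1 (2 * k + 1 + 1 + 1 + 1 + 1)) u₁
            (cupProduct (Nat.add_comm 1 (2 * k + 1 + 1 + 1 + 1)) u₂
              (cupProduct (Nat.add_comm 1 (2 * k + 1 + 1 + 1)) u₃
                (cupProduct (Nat.add_comm 1 (2 * k + 1 + 1)) u₄
                  (cupProduct (Nat.add_comm 1 (2 * k + 1)) (y a)
                    (cupProduct (show 1 + 2 * k = 2 * k + 1 by omega) (y c) (cupPow ℚ θ k))))))) • BettiUniverse.cup A.X 1 1 (b a) (b c) =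
      (2 * ((k + 2 : ℕ) : ℚ) * τ (cupProduct (Nat.add_comm 1 (2 * k + 1 + 1 + 1 + 1 + 1)) u₁
            (cupProduct (Nat.add_comm 1 (2 * k + 1 + 1 + 1 + 1)) u₂
              (cupProduct (Nat.add_comm 1 (2 * k + 1 + 1 + 1)) u₃
                (cupProduct (Nat.add_comm 1 (2 * k + 1 + 1)) u₄
                  (cupPow ℚ θ (k + 1))))))) • θ -
        (2 : ℚ) • (τ (cupProduct (Nat.add_comm 1 (2 * k + 1 + 1 + 1 + 1 + 1)) u₁
              (cupProduct (Nat.add_comm 1 (2 * k + 1 + 1 + 1 + 1)) u₂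
                (cupPow ℚ θ (k + 2)))) • BettiUniverse.cup A.X 1 1 u₃ u₄ -
          τ (cupProduct (Nat.add_comm 1 (2 * k + 1 + 1 + 1 + 1 + 1)) u₁
              (cupProduct (Nat.add_comm 1 (2 * k + 1 + 1 + 1 + 1)) u₃
                (cupPow ℚ θ (k + 2)))) • BettiUniverse.cup A.X 1 1 u₂ u₄ +
          τ (cupProduct (Nat.add_comm 1 (2 * k + 1 + 1 + 1 + 1 + 1)) u₂
              (cupProduct (Nat.add_comm 1 (2 * k + 1 + 1 + 1 + 1)) u₃
                (cupPow ℚ θ (k + 2)))) • BettiUniverse.cup A.X 1 1 u₁ u₄ +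
          τ (cupProduct (Nat.add_comm 1 (2 * k + 1 + 1 + 1 + 1 + 1)) u₁
              (cupProduct (Nat.add_comm 1 (2 * k + 1 + 1 + 1 + 1)) u₄
                (cupPow ℚ θ (k + 2)))) • BettiUniverse.cup A.X 1 1 u₂ u₃ -
          τ (cupProduct (Nat.add_comm 1 (2 * k + 1 + 1 + 1 + 1 + 1)) u₂
              (cupProduct (Nat.add_comm 1 (2 * k + 1 + 1 + 1 + 1)) u₄
                (cupPow ℚ θ (k + 2)))) • BettiUniverse.cup A.X 1 1 u₁ u₃ +
          τ (cupProduct (Nat.add_comm 1 (2 * k + 1 + 1 + 1 + 1 + 1)) u₃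
              (cupProduct (Nat.add_comm 1 (2 * k + 1 + 1 + 1 + 1)) u₄
                (cupPow ℚ θ (k + 2)))) • BettiUniverse.cup A.X 1 1 u₁ u₂) := by
  have h1 : ∀ z : bettiCohomology A.X 1, ∑ e, b.coord e z • b e = z := fun z ↦ by
    simp_rw [Module.Basis.coord_apply]; exact b.sum_repr z
  have hE := sum_cup_polarFamily_eq_two_smul A b hℓ
  -- the two index sums
  have Sa : ∑ a, ∑ c, b.coord c (y a) • BettiUniverse.cup A.X 1 1 (b a) (b c) = (2 : ℚ) • θ := by
    simp_rw [← map_smul, ← map_sum, h1, hE]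
  have Sc : ∀ z₁ z₂ : bettiCohomology A.X 1, ∑ a, ∑ c, (b.coord c z₁ * b.coord a z₂) • BettiUniverse.cup A.X 1 1 (b a) (b c) = BettiUniverse.cup A.X 1 1 z₂ z₁ := by
    intro z₁ z₂
    have : ∀ a c, (b.coord c z₁ * b.coord a z₂) • BettiUniverse.cup A.X 1 1 (b a) (b c) =
        BettiUniverse.cup A.X 1 1 (b.coord a z₂ • b a) (b.coord c z₁ • b c) := by
      intro a c
      rw [LinearMap.map_smul₂, map_smul, smul_smul, mul_comm]
    simp_rw [this, ← map_sum, h1, ← LinearMap.map_sum₂, h1]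
  -- abbreviations
  set P : bettiCohomology A.X 1 → bettiCohomology A.X 1 → ℚ := fun z z' ↦
    τ (cupProduct (Nat.add_comm 1 (2 * k + 1 + 1 + 1 + 1 + 1)) z (cupProduct (Nat.add_comm 1 (2 * k + 1 + 1 + 1 + 1)) z' (cupPow ℚ θ (k + 2)))) with hP
  set τ₀ : ℚ := τ (cupProduct (Nat.add_comm 1 (2 * k + 1 + 1 + 1 + 1 + 1)) u₁
            (cupProduct (Nat.add_comm 1 (2 * k + 1 + 1 + 1 + 1)) u₂
              (cupProduct (Nat.add_comm 1 (2 * k + 1 + 1 + 1)) u₃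
                (cupProduct (Nat.add_comm 1 (2 * k + 1 + 1)) u₄
                  (cupPow ℚ θ (k + 1)))))) with hτ₀
  -- the matching step and the level-(k+1) formulas, under `τ`
  have key : ∀ a c, (((k + 1) * (k + 2) : ℕ) : ℚ) * τ (cupProduct (Nat.add_comm 1 (2 * k + 1 + 1 + 1 + 1 + 1)) u₁
            (cupProduct (Nat.add_comm 1 (2 * k + 1 + 1 + 1 + 1)) u₂
              (cupProduct (Nat.add_comm 1 (2 * k + 1 + 1 + 1)) u₃
                (cupProduct (Nat.add_comm 1 (2 * k + 1 + 1)) u₄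
                  (cupProduct (Nat.add_comm 1 (2 * k + 1)) (y a)
                    (cupProduct (show 1 + 2 * k = 2 * k + 1 by omega) (y c) (cupPow ℚ θ k))))))) =
      ((k + 2 : ℕ) : ℚ) * (b.coord c (y a) * τ₀) -
        b.coord c u₄ * (b.coord a u₃ * P u₁ u₂ - b.coord a u₂ * P u₁ u₃ + b.coord a u₁ * P u₂ u₃) +
        b.coord c u₃ * (b.coord a u₄ * P u₁ u₂ - b.coord a u₂ * P u₁ u₄ + b.coord a u₁ * P u₂ u₄) -
        b.coord c u₂ * (b.coord a u₄ * P u₁ u₃ - b.coord a u₃ * P u₁ u₄ + b.coord a u₁ * P u₃ u₄) +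
        b.coord c u₁ * (b.coord a u₄ * P u₂ u₃ - b.coord a u₃ * P u₂ u₄ + b.coord a u₂ * P u₃ u₄) := by
    intro a c
    have hm := congrArg τ (smul_cup6_polar_cupPow A hk b hℓ c u₁ u₂ u₃ u₄ (y a))
    have t4 := congrArg τ (smul_cup_cup_cup_polar_cupPow' A hk b hℓ a u₁ u₂ u₃)
    have t3 := congrArg τ (smul_cup_cup_cup_polar_cupPow' A hk b hℓ a u₁ u₂ u₄)
    have t2 := congrArg τ (smul_cup_cup_cup_polar_cupPow' A hk b hℓ a u₁ u₃ u₄)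
    have t1 := congrArg τ (smul_cup_cup_cup_polar_cupPow' A hk b hℓ a u₂ u₃ u₄)
    simp only [map_smul, map_sub, map_add, smul_eq_mul] at hm t4 t3 t2 t1
    rw [Nat.cast_mul]
    linear_combination ((k + 2 : ℕ) : ℚ) * hm - b.coord c u₄ * t4 + b.coord c u₃ * t3 - b.coord c u₂ * t2 + b.coord c u₁ * t1
  -- split each summand
  have expand : ∀ a c,
      (((k + 2 : ℕ) : ℚ) * (b.coord c (y a) * τ₀) -
        b.coord c u₄ * (b.coord a u₃ * P u₁ u₂ - b.coord a u₂ * P u₁ u₃ + b.coord a u₁ * P u₂ u₃) +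
        b.coord c u₃ * (b.coord a u₄ * P u₁ u₂ - b.coord a u₂ * P u₁ u₄ + b.coord a u₁ * P u₂ u₄) -
        b.coord c u₂ * (b.coord a u₄ * P u₁ u₃ - b.coord a u₃ * P u₁ u₄ + b.coord a u₁ * P u₃ u₄) +
        b.coord c u₁ * (b.coord a u₄ * P u₂ u₃ - b.coord a u₃ * P u₂ u₄ + b.coord a u₂ * P u₃ u₄)) • BettiUniverse.cup A.X 1 1 (b a) (b c) =
      (((k + 2 : ℕ) : ℚ) * τ₀) • (b.coord c (y a) • BettiUniverse.cup A.X 1 1 (b a) (b c)) -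
        P u₁ u₂ • ((b.coord c u₄ * b.coord a u₃) • BettiUniverse.cup A.X 1 1 (b a) (b c)) + P u₁ u₃ • ((b.coord c u₄ * b.coord a u₂) • BettiUniverse.cup A.X 1 1 (b a) (b c)) -
        P u₂ u₃ • ((b.coord c u₄ * b.coord a u₁) • BettiUniverse.cup A.X 1 1 (b a) (b c)) +
        P u₁ u₂ • ((b.coord c u₃ * b.coord a u₄) • BettiUniverse.cup A.X 1 1 (b a) (b c)) - P u₁ u₄ • ((b.coord c u₃ * b.coord a u₂) • BettiUniverse.cup A.X 1 1 (b a) (b c)) +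
        P u₂ u₄ • ((b.coord c u₃ * b.coord a u₁) • BettiUniverse.cup A.X 1 1 (b a) (b c)) -
        P u₁ u₃ • ((b.coord c u₂ * b.coord a u₄) • BettiUniverse.cup A.X 1 1 (b a) (b c)) + P u₁ u₄ • ((b.coord c u₂ * b.coord a u₃) • BettiUniverse.cup A.X 1 1 (b a) (b c)) -
        P u₃ u₄ • ((b.coord c u₂ * b.coord a u₁) • BettiUniverse.cup A.X 1 1 (b a) (b c)) +
        P u₂ u₃ • ((b.coord c u₁ * b.coord a u₄) • BettiUniverse.cup A.X 1 1 (b a) (b c)) - P u₂ u₄ • ((b.coord c u₁ * b.coord a u₃) • BettiUniverse.cup A.X 1 1 (b a) (b c)) +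
        P u₃ u₄ • ((b.coord c u₁ * b.coord a u₂) • BettiUniverse.cup A.X 1 1 (b a) (b c)) := by
    intro a c
    simp only [smul_smul, ← sub_smul, ← add_smul]
    congr 1
    ring
  simp_rw [Finset.smul_sum, smul_smul, key, expand]
  simp only [Finset.sum_add_distrib, Finset.sum_sub_distrib]
  simp only [← Finset.smul_sum]
  rw [Sa]
  simp_rw [Sc]
  rw [BettiUniverse.cup_comm_one u₄ u₃, BettiUniverse.cup_comm_one u₄ u₂, BettiUniverse.cup_comm_one u₃ u₂, BettiUniverse.cup_comm_one u₄ u₁,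
    BettiUniverse.cup_comm_one u₃ u₁, BettiUniverse.cup_comm_one u₂ u₁, hτ₀]
  simp only [hP, smul_sub, smul_add, smul_neg, smul_smul]
  module

end Summit.HodgeConjecture.HodgeConjecture.Ring2.AbelianAll

end
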